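import Summits.Ventures.LatticeQCDFlow.Exactness.InvolutiveMetropolisIntegral
import Summits.Ventures.LatticeQCDFlow.Exactness.Phi4LeapfrogPerm
import Summits.Ventures.LatticeQCDFlow.Scoring.FreeFieldLeapfrogEnergy
import Summits.Ventures.LatticeQCDFlow.Scoring.SchwingerDysonPhi4GibbsMonomial
import HarnessLib

/-!
# The HMC update is exact for interacting lattice φ⁴ on `ℝ^Λ`

HONEST FRAMING: exact (Metropolis-corrected) sampling algorithms for lattice gauge theory;
figures of merit are autocorrelation/cost numbers at stated couplings and volumes; no
continuum-physics claim.  (SCALAR calibration rung S0-A: not a gauge result.)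

Venture `LatticeQCDFlow` (cell pub-lqcd), topic `Exactness`; FANOUT row 2 (`s0-phi4`: the HMC arm
of the 2D φ⁴ calibration and the integrator leg of the exactness battery).  NEW WORK of the cell
over Mathlib; nothing is cited as a fact.  Printed counterparts, named only:
Duane–Kennedy–Pendleton–Roweth 1987 (HMC), Mehlig–Heermann–Forrest 1992 and Neal 1993/2011
(HMC is exact for any volume-preserving reversible integrator), Lüscher 2010 §6.

Relation to the tree.  Rows 9/30 proved the SKELETON (`InvolutiveMetropolis.involMH_invariant`,
`SplittingIntegrator.flatLeapfrogHMC_isReversible`: abstract phase space, set-wise, as Mathlib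
kernels).  Row 2's `Exactness/Phi4LeapfrogPerm.lean` identified the engine's concrete step
`leapfrogQPQ J λ δ` with row 9's permutation (`hmcProposal` = flip ∘ leapfrog^N is a
measure-preserving involution of `ℝ^Λ × ℝ^Λ`), and `Exactness/InvolutiveMetropolisIntegral.lean`
put the involutive Metropolis step in integrated form.  This file adds the MOMENTUM REFRESH and
the marginalisation to the configuration, i.e. the HMC update as the code runs it.

## What is proved

* §pqp (any finite `Λ`).  The engine's secondary integrator as well: `driftHom τ = τ•id`,
  **`leapfrogPQP_eq_perm`** — `leapfrogPQP J λ δ = ⇑(kick (−(δ/2)F) * drift (addDrift δ) * kick (−(δ/2)F))`,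
  a palindrome of row 9's reversible permutations; so `hmcProposalPQP = momFlip ∘ leapfrogPQP^[N]`
  is `⇑(flip * (kick*drift*kick)^N)` (`hmcProposalPQP_eq_perm`), an involution
  (`hmcProposalPQP_involutive`), measurable, and Lebesgue-preserving
  (`measurePreserving_hmcProposalPQP`) — the qpq twin is `Exactness/Phi4LeapfrogPerm.lean`.
* §3 (lattice `Fin (n+1) → ℝ`, Lebesgue measure; `S = latticePhi4Action J λ`).
  `phi4HmcEnergy J λ (φ, p) = S(φ) + ½Σp²` (`= Scoring.hmcEnergy J` at `λ = 0`,
  `phi4HmcEnergy_zero`; measurable); `momentumWeight p = e^{−½Σp²}` (the refresh law `N(0,1)^Λ`,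
  unnormalised) `= gibbsWeight (½·𝟙) 0 p` (`latticePhi4Action_halfDiag`: the kinetic energy is a
  diagonal free action, so row 2's coercivity lemmas give `integrable_momentumWeight`), its mass
  `momentumZ n > 0` (`momentumZ_pos`); **`exp_neg_phi4HmcEnergy`** — `e^{−H} = e^{−S(φ)} e^{−½Σp²}`.
* **`hmcOpOf J λ Ψ f φ = Z_p⁻¹ ∫ [a f((Ψ(φ,p)).1) + (1 − a) f(φ)] e^{−½Σp²} dp`**,
  `a = min(1, e^{H(φ,p) − H(Ψ(φ,p))})` — an HMC-TYPE UPDATE of the configuration built on ANY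
  proposal map `Ψ` of phase space (refresh `p ∼ N(0,1)^Λ`, propose `Ψ(φ,p)`, Metropolis test,
  else stay); `hmcOpPhi4 J λ δ N` = the engine's update (`Ψ = hmcProposal`: `N` qpq steps of
  size `δ`, then flip), `hmcOpPQP` (pqp).
* **`hmc_exact_of_involutive`** — for EVERY measurable Lebesgue-preserving involution `Ψ` of
  `ℝ^Λ × ℝ^Λ`, every real `J`, `λ`, and every measurable `f` with `f e^{−S}` integrable:
  `∫ (K_Ψ f) e^{−S} dφ = ∫ f e^{−S} dφ` (Fubini to phase space; `involOp_integral_invariant`;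
  Fubini back: `∫∫ f e^{−H} = Z_p ∫ f e^{−S}`) — any reversible volume-preserving integrator, any
  step size and length: accuracy only drives the acceptance.  Instances **`hmc_exact`** (qpq,
  every `δ`, `N`), `hmcPQP_exact`; `hmc_exact_of_bounded` (coercive action, bounded `f`),
  `hmc_exact_expect` (`⟨K f⟩ = ⟨f⟩`), **`hmc_exact_phi4`** — EVERY `λ > 0`, EVERY real `J` (the AKS
  2019 sets `m² = −4` included), EVERY `δ`, `N`: the Metropolis-corrected HMC update leaves the φ⁴
  Gibbs law invariant; `hmc_exact_monomial` — the same for every monomial moment `Π φ_w^{k_w}`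
  (the battery's `⟨φ²⟩`, `⟨φ⁴⟩`, `G(x,y)` columns: unbounded observables).  What `δ`, `N` move is
  the acceptance (`Scoring/FreeFieldLeapfrogEnergy.lean`: `ΔH = (δ²/4)(S(p_N) − S(p_0))` for qpq,
  `(δ²/8)(|F(φ_N)|² − |F(φ_0)|²)` for pqp, at `λ = 0`), never the sampled law.

With `Exactness/Phi4LocalMetropolisExact.lean`, `Exactness/SweepExact.lean` and
`Exactness/Phi4IndependenceSamplerExact.lean`, all three sampler families of the S0-A calibration
(local Metropolis, flow / independence Metropolis, HMC) are typed CONCRETELY as exact for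
interacting φ⁴ on `ℝ^Λ`, in one and the same integrated form.  NOT CLAIMED: irreducibility /
ergodicity of the HMC chain, anything about its autocorrelations, floating-point reversibility.
-/

namespace Summit.Ventures.LatticeQCDFlow.Exactness

open Real MeasureTheory Finset Filter
open Summit.Ventures.LatticeQCDFlow.Scoring

/-! ## The pqp variant of the engine (`hmcpqp`): kick–drift–kick is a reversible palindrome too -/

section PQP

variable {Λ : Type*} [Fintype Λ]

/-- The flat drift homomorphism `p ↦ τ p` (`halfDrift δ = driftHom (δ/2)`). -/
noncomputable def driftHom (τ : ℝ) : (Λ → ℝ) →+ (Λ → ℝ) :=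
  DistribSMul.toAddMonoidHom (Λ → ℝ) τ

omit [Fintype Λ] in
/-- The half drift of the qpq file is `driftHom (δ/2)`. -/
theorem halfDrift_eq_driftHom (δ : ℝ) : halfDrift (Λ := Λ) δ = driftHom (δ / 2) := rfl

omit [Fintype Λ] in
/-- The drift homomorphism is measurable. -/
theorem measurable_driftHom (τ : ℝ) : Measurable (driftHom (Λ := Λ) τ) := by
  change Measurable fun p : Λ → ℝ => τ • p
  exact measurable_id.const_smul τ

/-- **The pqp HMC proposal map**: `N` kick–drift–kick steps `leapfrogPQP J λ δ`
(`Scoring/FreeFieldLeapfrogEnergy.lean`, the engine's secondary integrator), then the flip. -/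
noncomputable def hmcProposalPQP (J : Λ → Λ → ℝ) (lam δ : ℝ) (N : ℕ)
    (z : (Λ → ℝ) × (Λ → ℝ)) : (Λ → ℝ) × (Λ → ℝ) :=
  momFlip ((leapfrogPQP J lam δ)^[N] z)

/-- **Row 2's pqp step is the palindrome `kick * drift * kick`** of row 9's permutations (half
kicks `−(δ/2)F`, full flat drift `q ↦ q + δ p`). -/
theorem leapfrogPQP_eq_perm (J : Λ → Λ → ℝ) (lam δ : ℝ) :
    leapfrogPQP J lam δ
      = ⇑(kick (kickIncrement J lam (δ / 2)) * drift (addDrift (driftHom (Λ := Λ) δ))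
          * kick (kickIncrement J lam (δ / 2))) := by
  funext z
  rw [Equiv.Perm.coe_mul, Equiv.Perm.coe_mul, Function.comp_apply, Function.comp_apply]
  simp only [leapfrogPQP, lfDrift_eq_add_smul, lfKick_eq_add_kickIncrement]
  rfl

/-- Hence the pqp proposal map is `flip * (kick * drift * kick) ^ N`. -/
theorem hmcProposalPQP_eq_perm (J : Λ → Λ → ℝ) (lam δ : ℝ) (N : ℕ) :
    hmcProposalPQP J lam δ N
      = ⇑((flip : Equiv.Perm ((Λ → ℝ) × (Λ → ℝ)))
          * (kick (kickIncrement J lam (δ / 2)) * drift (addDrift (driftHom (Λ := Λ) δ))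
              * kick (kickIncrement J lam (δ / 2))) ^ N) := by
  funext z
  rw [Equiv.Perm.coe_mul, Equiv.Perm.coe_pow, Function.comp_apply, ← leapfrogPQP_eq_perm]
  rfl

/-- **The pqp proposal map is an involution** (palindromes of reversible maps are reversible). -/
theorem hmcProposalPQP_involutive (J : Λ → Λ → ℝ) (lam δ : ℝ) (N : ℕ) :
    Function.Involutive (hmcProposalPQP J lam δ N) := by
  rw [hmcProposalPQP_eq_perm]
  exact (((kick_isFlipReversible _).palindrome (drift_isFlipReversible (addDrift_reversal _))
    flip_mul_flip).pow flip_mul_flip N).involutive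

/-- The pqp proposal map is measurable. -/
theorem measurable_hmcProposalPQP (J : Λ → Λ → ℝ) (lam δ : ℝ) (N : ℕ) :
    Measurable (hmcProposalPQP J lam δ N) := by
  rw [hmcProposalPQP_eq_perm, Equiv.Perm.coe_mul, Equiv.Perm.coe_pow]
  refine measurable_flip.comp (Measurable.iterate ?_ N)
  rw [Equiv.Perm.coe_mul, Equiv.Perm.coe_mul]
  exact ((measurable_kick (measurable_kickIncrement J lam (δ / 2))).comp
    (measurable_drift (measurable_addDrift (measurable_driftHom δ)))).comp
      (measurable_kick (measurable_kickIncrement J lam (δ / 2)))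

/-- **The pqp proposal map preserves Lebesgue measure on phase space.** -/
theorem measurePreserving_hmcProposalPQP (J : Λ → Λ → ℝ) (lam δ : ℝ) (N : ℕ) :
    MeasurePreserving (hmcProposalPQP J lam δ N)
      ((volume : Measure (Λ → ℝ)).prod volume) ((volume : Measure (Λ → ℝ)).prod volume) := by
  haveI := isNegInvariant_volume_pi (Λ := Λ)
  rw [hmcProposalPQP_eq_perm, Equiv.Perm.coe_mul]
  refine measurePreserving_flip.comp (measurePreserving_perm_pow ?_ N)
  rw [Equiv.Perm.coe_mul, Equiv.Perm.coe_mul]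
  exact ((measurePreserving_kick (measurable_kickIncrement J lam (δ / 2))).comp
    (measurePreserving_drift (measurable_addDrift (measurable_driftHom δ))
      (measurePreserving_addDrift _))).comp
        (measurePreserving_kick (measurable_kickIncrement J lam (δ / 2)))

end PQP

/-! ## §3 The HMC update of the configuration is exact for lattice φ⁴ -/

section Lattice

variable {n : ℕ}

/-- The HMC energy `H(φ, p) = S(φ) + ½ Σ_x p_x²` (φ⁴ action `latticePhi4Action J λ`, unit
masses). -/
noncomputable def phi4HmcEnergy (J : Fin (n + 1) → Fin (n + 1) → ℝ) (lam : ℝ)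
    (z : (Fin (n + 1) → ℝ) × (Fin (n + 1) → ℝ)) : ℝ :=
  latticePhi4Action J lam z.1 + (∑ x, z.2 x ^ 2) / 2

/-- At `λ = 0` this is the free-field `Scoring.hmcEnergy` of `FreeFieldLeapfrogEnergy.lean`. -/
theorem phi4HmcEnergy_zero (J : Fin (n + 1) → Fin (n + 1) → ℝ) :
    phi4HmcEnergy J 0 = hmcEnergy J := rfl

/-- The HMC energy is measurable (continuous). -/
theorem measurable_phi4HmcEnergy (J : Fin (n + 1) → Fin (n + 1) → ℝ) (lam : ℝ) :
    Measurable (phi4HmcEnergy J lam) := by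
  refine Continuous.measurable ?_
  unfold phi4HmcEnergy
  exact ((continuous_latticePhi4Action J lam).comp continuous_fst).add
    ((continuous_finsetSum _ fun x _ => ((continuous_apply x).comp continuous_snd).pow 2).div_const 2)

/-- The Gaussian momentum weight `e^{−½Σp²}` (unnormalised law `N(0,1)^Λ` of the refresh). -/
noncomputable def momentumWeight (p : Fin (n + 1) → ℝ) : ℝ :=
  Real.exp (-(∑ x, p x ^ 2) / 2)

/-- Its mass `Z_p = ∫ e^{−½Σp²} dp` (`= (2π)^{(n+1)/2}`, a value never used: only `0 < Z_p`). -/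
noncomputable def momentumZ (n : ℕ) : ℝ :=
  ∫ p : Fin (n + 1) → ℝ, momentumWeight p

/-- The diagonal coupling matrix `½·𝟙`, for which the "action" is the kinetic energy. -/
noncomputable def halfDiag (n : ℕ) : Fin (n + 1) → Fin (n + 1) → ℝ :=
  fun x y => if x = y then 1 / 2 else 0

/-- `latticePhi4Action (½·𝟙) 0 p = ½ Σ p²`: the kinetic energy is a (free, diagonal) lattice action. -/
theorem latticePhi4Action_halfDiag (p : Fin (n + 1) → ℝ) :
    latticePhi4Action (halfDiag n) 0 p = (∑ x, p x ^ 2) / 2 := by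
  unfold latticePhi4Action halfDiag
  have h : ∀ x : Fin (n + 1),
      ∑ y, p x * (if x = y then (1 : ℝ) / 2 else 0) * p y = p x ^ 2 / 2 := by
    intro x
    simp only [mul_ite, mul_zero, ite_mul, zero_mul, Finset.sum_ite_eq, Finset.mem_univ, if_true]
    ring
  simp only [h, zero_mul, add_zero, Finset.sum_div]

/-- The momentum weight is the Gibbs weight of that diagonal action. -/
theorem momentumWeight_eq_gibbsWeight (p : Fin (n + 1) → ℝ) :
    momentumWeight p = gibbsWeight (halfDiag n) 0 p := by
  rw [gibbsWeight, latticePhi4Action_halfDiag, momentumWeight, neg_div]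

/-- The momentum weight is integrable. -/
theorem integrable_momentumWeight : Integrable (momentumWeight (n := n)) := by
  have h : momentumWeight (n := n) = gibbsWeight (halfDiag n) 0 :=
    funext momentumWeight_eq_gibbsWeight
  rw [h]
  refine integrable_gibbsWeight_of_coercive (ε := 1 / 2) (K := 0) (by norm_num) fun p => ?_
  rw [latticePhi4Action_halfDiag]
  linarith

/-- The momentum weight is measurable (continuous). -/
theorem measurable_momentumWeight : Measurable (momentumWeight (n := n)) := by
  unfold momentumWeight
  fun_prop

/-- `Z_p > 0`. -/
theorem momentumZ_pos (n : ℕ) : 0 < momentumZ n := by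
  unfold momentumZ
  have h := integrable_momentumWeight (n := n)
  unfold momentumWeight at h ⊢
  exact integral_exp_pos h

/-- **The phase-space weight factorises**: `e^{−H(φ,p)} = e^{−S(φ)} · e^{−½Σp²}`. -/
theorem exp_neg_phi4HmcEnergy (J : Fin (n + 1) → Fin (n + 1) → ℝ) (lam : ℝ)
    (z : (Fin (n + 1) → ℝ) × (Fin (n + 1) → ℝ)) :
    Real.exp (-phi4HmcEnergy J lam z) = gibbsWeight J lam z.1 * momentumWeight z.2 := by
  rw [gibbsWeight, momentumWeight, ← Real.exp_add, phi4HmcEnergy]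
  congr 1
  ring

/-- An HMC-TYPE UPDATE of the configuration built on ANY proposal map `Ψ` of phase space, as an
operator on observables: refresh the momenta from `N(0,1)^Λ`, propose `Ψ(φ, p)`, accept with
`min(1, e^{H(φ,p) − H(Ψ(φ,p))})` (`involAccept`), else keep `φ`:
`(K_Ψ f)(φ) = Z_p⁻¹ ∫ [a f((Ψ(φ,p)).1) + (1 − a) f(φ)] e^{−½Σp²} dp`. -/
noncomputable def hmcOpOf (J : Fin (n + 1) → Fin (n + 1) → ℝ) (lam : ℝ)
    (Ψ : (Fin (n + 1) → ℝ) × (Fin (n + 1) → ℝ) → (Fin (n + 1) → ℝ) × (Fin (n + 1) → ℝ))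
    (f : (Fin (n + 1) → ℝ) → ℝ) (φ : Fin (n + 1) → ℝ) : ℝ :=
  (∫ p, (involAccept (phi4HmcEnergy J lam) Ψ (φ, p) * f (Ψ (φ, p)).1
      + (1 - involAccept (phi4HmcEnergy J lam) Ψ (φ, p)) * f φ) * momentumWeight p) / momentumZ n

/-- **ONE HMC UPDATE of the configuration** (the engine's primary integrator): refresh
`p ∼ N(0,1)^Λ`, run `N` qpq leapfrog steps of size `δ`, flip, Metropolis test `min(1, e^{−ΔH})`,
else keep `φ` — `hmcOpOf` with `Ψ = hmcProposal J λ δ N`. -/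
noncomputable def hmcOpPhi4 (J : Fin (n + 1) → Fin (n + 1) → ℝ) (lam δ : ℝ) (N : ℕ)
    (f : (Fin (n + 1) → ℝ) → ℝ) (φ : Fin (n + 1) → ℝ) : ℝ :=
  hmcOpOf J lam (hmcProposal J lam δ N) f φ

/-- The same update run with the pqp integrator (`hmcpqp`): `Ψ = hmcProposalPQP J λ δ N`. -/
noncomputable def hmcOpPQP (J : Fin (n + 1) → Fin (n + 1) → ℝ) (lam δ : ℝ) (N : ℕ)
    (f : (Fin (n + 1) → ℝ) → ℝ) (φ : Fin (n + 1) → ℝ) : ℝ :=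
  hmcOpOf J lam (hmcProposalPQP J lam δ N) f φ

/-- **EVERY MEASURABLE, LEBESGUE-PRESERVING INVOLUTION OF PHASE SPACE GIVES AN EXACT HMC-TYPE
UPDATE FOR LATTICE φ⁴** — whatever integrator produced it (qpq / pqp leapfrog, OMF2, OMF4, any
symmetric splitting, any step size and length; accuracy only drives the acceptance).  For every
real `J`, `λ` and every measurable `f` with `f e^{−S}` integrable:
`∫ (K_Ψ f) e^{−S} dφ = ∫ f e^{−S} dφ`. -/
theorem hmc_exact_of_involutive {J : Fin (n + 1) → Fin (n + 1) → ℝ} {lam : ℝ}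
    {Ψ : (Fin (n + 1) → ℝ) × (Fin (n + 1) → ℝ) → (Fin (n + 1) → ℝ) × (Fin (n + 1) → ℝ)}
    (hΨm : Measurable Ψ) (hΨi : Function.Involutive Ψ)
    (hΨμ : MeasurePreserving Ψ ((volume : Measure (Fin (n + 1) → ℝ)).prod volume)
      ((volume : Measure (Fin (n + 1) → ℝ)).prod volume))
    {f : (Fin (n + 1) → ℝ) → ℝ} (hfm : Measurable f)
    (hfw : Integrable (fun φ => f φ * gibbsWeight J lam φ)) :
    ∫ φ, hmcOpOf J lam Ψ f φ * gibbsWeight J lam φ = ∫ φ, f φ * gibbsWeight J lam φ := by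
  set H := phi4HmcEnergy J lam with hH
  set g : (Fin (n + 1) → ℝ) × (Fin (n + 1) → ℝ) → ℝ := fun z => f z.1 with hg
  have hHm : Measurable H := measurable_phi4HmcEnergy J lam
  have hgm : Measurable g := hfm.comp measurable_fst
  -- the phase-space weight factorises
  have hW : ∀ φ p, Real.exp (-H (φ, p)) = gibbsWeight J lam φ * momentumWeight p :=
    fun φ p => exp_neg_phi4HmcEnergy J lam (φ, p)
  have hgw : Integrable (fun z => g z * Real.exp (-H z))
      ((volume : Measure (Fin (n + 1) → ℝ)).prod volume) := by
    refine (hfw.mul_prod integrable_momentumWeight).congr (Eventually.of_forall fun z => ?_)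
    obtain ⟨φ, p⟩ := z
    simp only [hg, hW φ p]
    ring
  -- the involutive Metropolis step preserves `e^{−H} dφ dp` (integrated form)
  have key := involOp_integral_invariant hHm hΨm hΨi hΨμ hgm hgw
  have hint : Integrable (fun z => involOp H Ψ g z * Real.exp (-H z))
      ((volume : Measure (Fin (n + 1) → ℝ)).prod volume) :=
    integrable_involOp_mul hHm hΨm hΨμ hgm hgw
  have hZ : 0 < momentumZ n := momentumZ_pos n
  -- the operator is `Z_p⁻¹ ∫_p (involOp g)(φ, p) e^{−½Σp²}`
  have hop : ∀ φ, hmcOpOf J lam Ψ f φ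
      = (∫ p, involOp H Ψ g (φ, p) * momentumWeight p) / momentumZ n := fun φ => rfl
  -- Fubini: `∫_φ (∫_p … e^{−½Σp²}) e^{−S(φ)} = ∫∫ … e^{−H}`
  have hfub : ∫ φ, (∫ p, involOp H Ψ g (φ, p) * momentumWeight p) * gibbsWeight J lam φ
      = ∫ z, involOp H Ψ g z * Real.exp (-H z)
          ∂((volume : Measure (Fin (n + 1) → ℝ)).prod volume) := by
    rw [integral_prod _ hint]
    refine integral_congr_ae (Eventually.of_forall fun φ => ?_)
    dsimp only
    rw [← integral_mul_const]
    refine integral_congr_ae (Eventually.of_forall fun p => ?_)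
    dsimp only
    rw [hW φ p]
    ring
  have hrhs : ∫ z, g z * Real.exp (-H z) ∂((volume : Measure (Fin (n + 1) → ℝ)).prod volume)
      = (∫ φ, f φ * gibbsWeight J lam φ) * momentumZ n := by
    unfold momentumZ
    rw [← integral_prod_mul]
    refine integral_congr_ae (Eventually.of_forall fun z => ?_)
    obtain ⟨φ, p⟩ := z
    simp only [hg, hW φ p]
    ring
  calc ∫ φ, hmcOpOf J lam Ψ f φ * gibbsWeight J lam φ
      = ∫ φ, ((∫ p, involOp H Ψ g (φ, p) * momentumWeight p) * gibbsWeight J lam φ)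
          / momentumZ n := by
        refine integral_congr_ae (Eventually.of_forall fun φ => ?_)
        dsimp only
        rw [hop]
        ring
    _ = (∫ z, involOp H Ψ g z * Real.exp (-H z)
          ∂((volume : Measure (Fin (n + 1) → ℝ)).prod volume)) / momentumZ n := by
        rw [integral_div, hfub]
    _ = ∫ φ, f φ * gibbsWeight J lam φ := by
        rw [key, hrhs, mul_div_cancel_right₀ _ hZ.ne']

/-- **THE HMC UPDATE IS EXACT FOR LATTICE φ⁴ ON `ℝ^Λ`** — every real `J`, `λ`, every step size
`δ`, every trajectory length `N`, every measurable observable `f` with `f e^{−S}` integrable: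
`∫ (K f) e^{−S} dφ = ∫ f e^{−S} dφ`. -/
theorem hmc_exact {J : Fin (n + 1) → Fin (n + 1) → ℝ} {lam : ℝ} (δ : ℝ) (N : ℕ)
    {f : (Fin (n + 1) → ℝ) → ℝ} (hfm : Measurable f)
    (hfw : Integrable (fun φ => f φ * gibbsWeight J lam φ)) :
    ∫ φ, hmcOpPhi4 J lam δ N f φ * gibbsWeight J lam φ = ∫ φ, f φ * gibbsWeight J lam φ :=
  hmc_exact_of_involutive (measurable_hmcProposal J lam δ N) (hmcProposal_involutive J lam δ N)
    (measurePreserving_hmcProposal J lam δ N) hfm hfw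

/-- **The pqp integrator gives an exact update too** (same statement for `hmcOpPQP`). -/
theorem hmcPQP_exact {J : Fin (n + 1) → Fin (n + 1) → ℝ} {lam : ℝ} (δ : ℝ) (N : ℕ)
    {f : (Fin (n + 1) → ℝ) → ℝ} (hfm : Measurable f)
    (hfw : Integrable (fun φ => f φ * gibbsWeight J lam φ)) :
    ∫ φ, hmcOpPQP J lam δ N f φ * gibbsWeight J lam φ = ∫ φ, f φ * gibbsWeight J lam φ :=
  hmc_exact_of_involutive (measurable_hmcProposalPQP J lam δ N)
    (hmcProposalPQP_involutive J lam δ N) (measurePreserving_hmcProposalPQP J lam δ N) hfm hfw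

/-- **Bounded observables** under a coercive action: `∫ (K f) e^{−S} dφ = ∫ f e^{−S} dφ`. -/
theorem hmc_exact_of_bounded {J : Fin (n + 1) → Fin (n + 1) → ℝ} {lam ε K : ℝ} (hε : 0 < ε)
    (hS : ∀ φ : Fin (n + 1) → ℝ, ε * ∑ w, φ w ^ 2 - K ≤ latticePhi4Action J lam φ)
    (δ : ℝ) (N : ℕ) {f : (Fin (n + 1) → ℝ) → ℝ} (hfm : Measurable f) {B : ℝ}
    (hfb : ∀ φ, |f φ| ≤ B) :
    ∫ φ, hmcOpPhi4 J lam δ N f φ * gibbsWeight J lam φ = ∫ φ, f φ * gibbsWeight J lam φ := by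
  refine hmc_exact δ N hfm ?_
  refine Integrable.mono' ((integrable_gibbsWeight_of_coercive hε hS).const_mul B)
    (hfm.mul (continuous_gibbsWeight J lam).measurable).aestronglyMeasurable
    (Eventually.of_forall fun φ => ?_)
  rw [Real.norm_eq_abs, abs_mul, abs_of_pos (gibbsWeight_pos J lam φ)]
  exact mul_le_mul_of_nonneg_right (hfb φ) (gibbsWeight_pos J lam φ).le

/-- **Normalised form**: `⟨K f⟩ = ⟨f⟩` in the Gibbs law (coercive action, bounded measurable `f`). -/
theorem hmc_exact_expect {J : Fin (n + 1) → Fin (n + 1) → ℝ} {lam ε K : ℝ} (hε : 0 < ε)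
    (hS : ∀ φ : Fin (n + 1) → ℝ, ε * ∑ w, φ w ^ 2 - K ≤ latticePhi4Action J lam φ)
    (δ : ℝ) (N : ℕ) {f : (Fin (n + 1) → ℝ) → ℝ} (hfm : Measurable f) {B : ℝ}
    (hfb : ∀ φ, |f φ| ≤ B) :
    gibbsExpect J lam (hmcOpPhi4 J lam δ N f) = gibbsExpect J lam f := by
  unfold gibbsExpect
  rw [hmc_exact_of_bounded hε hS δ N hfm hfb]

/-- **Every `λ > 0`, every real coupling matrix, every step size, every trajectory length** (the
AKS 2019 sets `m² = −4` included): the Metropolis-corrected HMC update leaves the φ⁴ Gibbs law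
invariant — `δ` and `N` only move the acceptance, never the sampled law. -/
theorem hmc_exact_phi4 {lam : ℝ} (hlam : 0 < lam) (J : Fin (n + 1) → Fin (n + 1) → ℝ)
    (δ : ℝ) (N : ℕ) {f : (Fin (n + 1) → ℝ) → ℝ} (hfm : Measurable f) {B : ℝ}
    (hfb : ∀ φ, |f φ| ≤ B) :
    gibbsExpect J lam (hmcOpPhi4 J lam δ N f) = gibbsExpect J lam f :=
  hmc_exact_expect one_pos (latticePhi4Action_coercive hlam J) δ N hfm hfb

/-- **Polynomial observables** (`λ > 0`): the identity holds for every monomial moment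
`Π_w φ_w^{k_w}` — the columns of the exactness battery (`⟨φ²⟩`, `⟨φ⁴⟩`, two-point functions). -/
theorem hmc_exact_monomial {lam : ℝ} (hlam : 0 < lam) (J : Fin (n + 1) → Fin (n + 1) → ℝ)
    (δ : ℝ) (N : ℕ) (k : Fin (n + 1) → ℕ) :
    ∫ φ, hmcOpPhi4 J lam δ N (fun φ => ∏ w, φ w ^ k w) φ * gibbsWeight J lam φ
      = ∫ φ : Fin (n + 1) → ℝ, (∏ w, φ w ^ k w) * gibbsWeight J lam φ :=
  hmc_exact δ N (by fun_prop)
    (integrable_monomial_mul_gibbsWeight_of_coercive one_pos (latticePhi4Action_coercive hlam J) k)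

end Lattice

end Summit.Ventures.LatticeQCDFlow.Exactness
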